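import Summits.ValiantsHypothesis.ValiantsHypothesis.Theorems.LacunarySymmetroidMatrixDescartesCensusPivotKit
import Summits.ValiantsHypothesis.ValiantsHypothesis.Theorems.LacunarySymmetroidMatrixDescartesPivotTwoFourWitness

/-!
# `MatrixDescartes` (stmt-ValiantsHypothesis-18050) — a NEGATIVE-DEFINITE pivot does NOT give the K-free bound `2n`:
# a `2 × 2` pivot pencil with `J = −1000·1`, four PSD rank-one letters and SIX positive roots (`6 > 4 = 2n`)

HONEST FRAMING.  Cell `pub-symmetroid`, seat `val-sym-mdr-p2` (gen 11); helper file `--supports` the crux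
`Theses.LacunarySymmetroid.MatrixDescartes` (OPEN), NO closure claim.  It REFUTES a located question of this seat's own lineage
(memo MOMENT-LAW.md §2–§3 of gen 10, credence 0.7 there): «is `Z₊ ≤ 2n` true for every pivot pencil
`X^e J + ∑ X^{d k} P k` whose pivot letter is negative semidefinite (`J ⪯ 0`, all `P k ⪰ 0`), uniformly in the number of
letters and the exponents?»  The tree has: `Z₊ ≤ 2K` for such pencils at `n = 2`
(`Pivot.DefinitePivot.pivotTwo_posRoots_le_two_mul_of_negSemidef_pivot`, Descartes), `Z₊ ≤ 2n` as soon as ONE scale `x₀` has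
`F(x₀) ≺ 0` (`negMoment_posRoots_le`, gen 10), and `Z₊ ≤ 2n` when the negative block DOMINATES at one scale (`dominantMiddle`,
gen 4).  ANSWER (this file): **NO** — the sign condition on the pivot alone is not K-free already at `n = 2`, `K = 4`:

  `F(X) = [[5400, 3600], [3600, 2400]] + X⁵ · [[3000, 3000], [3000, 3000]] − 1000 · X⁶ · 1 + X⁷ · [[140, 560], [560, 2240]]
          + X¹² · [[3, 24], [24, 192]]`

(pivot `J = −1000·1 ≺ 0` at exponent `6`; PSD rank-one letters `600·(3,2)(3,2)ᵀ`, `3000·(1,1)(1,1)ᵀ`, `140·(1,4)(1,4)ᵀ`,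
`3·(1,8)(1,8)ᵀ` at exponents `0, 5 | 7, 12` — two below, two above the pivot) has
  `det F(X) = X⁵ · (1800000 − 7800000 X + 8400000 X² − 6000000 X⁶ + 5651200 X⁷ − 2380000 X⁸ + 441000 X¹² − 195000 X¹³ + 6720 X¹⁴)`,
whose signs at `X = 1/100, 9/20, 4/5, 6/5, 7/4, 8, 100` are `+ − + − + − +`: at least SIX distinct positive roots
(**`six_le_pivotPosRoots`**; exact count by Sturm, seat script exp/final_cert.py: exactly 6 positive, 2 negative; Descartes
allows 8), hence **`not_nsdPivotLaw_two`**: `¬ (∀ K e d J P, J symmetric → −J ⪰ 0 → (∀ k, P k ⪰ 0) → Z₊ ≤ 2·2)`, and the same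
with `−J ≻ 0` (**`not_negDefPivotLaw_two`**).
MECHANISM (paper, seat NOTES): with `C(t) = ∑ e^{(d k − 6)t} P k`, `t = log X`, the roots are the solutions of
`λ_min(C(t)) = 1000` (here `λ_max > 1000` throughout); `λ_min` has TWO interior local maxima (near `t ≈ −1.1` and
`t ≈ 0.8`) separating three dips — so the «valley form» (V) and the level-set form (V′) of the memo are false as well; no
negative-definite moment exists (consistent with `negMoment_posRoots_le`).  Consequently a K-free two-sided law for NSD pivots
needs a MAGNITUDE hypothesis (moment / dominance), not the sign alone.  Nothing here bears on `MatrixDescartes` in its window,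
on `DoorA26` / `DoorA34` (a pivot count is not a `ζ_sym` row: `6 < ζ_sym(2,5) = 14`), on the cell's registers, or on `VP ≠ VNP`.

[folklore] Intermediate value theorem at rational points (`norm_num`) through the tree's certificate kit
`Pivot.le_pivotPosRoots_of_certificate`; the object is this seat's (annealed search on the 7-point alternation margin of
`λ_min`, continuation in the fast exponent, integer directions, exact rational re-verification).
-/

-- `Summit.ValiantsHypothesis.ValiantsHypothesis.…` repeats a component by the D-0017 layout
-- (single-conjunct summit), which the `dupNamespace` linter flags; the name is mandated.
set_option linter.dupNamespace false

namespace Summit.ValiantsHypothesis.ValiantsHypothesis.Theorems.LacunarySymmetroidMatrixDescartes.Pivot.NsdPivotSix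

open scoped BigOperators Matrix

/-- Closed form of `det F(t)` for the explicit pencil (pivot `−1000·1` at exponent `6`; letters at `7, 5, 0, 12`).
The literals ARE the certificate's data. [folklore] -/
theorem eval_det (t : ℝ) :
    (t ^ 6 • (!![(-1000 : ℝ), 0; 0, (-1000 : ℝ)] : Matrix (Fin 2) (Fin 2) ℝ)
      + ∑ k, t ^ (![7, 5, 0, 12] : Fin 4 → ℕ) k •
        (![!![(140 : ℝ), 560; 560, 2240], !![(3000 : ℝ), 3000; 3000, 3000], !![(5400 : ℝ), 3600; 3600, 2400],
          !![(3 : ℝ), 24; 24, 192]] : Fin 4 → Matrix (Fin 2) (Fin 2) ℝ) k).det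
      = 1800000 * t ^ 5 - 7800000 * t ^ 6 + 8400000 * t ^ 7 - 6000000 * t ^ 11 + 5651200 * t ^ 12
          - 2380000 * t ^ 13 + 441000 * t ^ 17 - 195000 * t ^ 18 + 6720 * t ^ 19 := by
  rw [Matrix.det_fin_two]
  simp [Matrix.add_apply, Fin.sum_univ_four]
  ring

/-- The pivot letter is symmetric. [folklore] -/
theorem J_isSymm : (!![(-1000 : ℝ), 0; 0, (-1000 : ℝ)] : Matrix (Fin 2) (Fin 2) ℝ).IsSymm := by
  unfold Matrix.IsSymm; ext i j; fin_cases i <;> fin_cases j <;> rfl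

/-- The pivot letter is negative semidefinite: `−J = 1000 · 1 ⪰ 0`. [folklore] -/
theorem neg_J_posSemidef : (-(!![(-1000 : ℝ), 0; 0, (-1000 : ℝ)] : Matrix (Fin 2) (Fin 2) ℝ)).PosSemidef := by
  have h : -(!![(-1000 : ℝ), 0; 0, (-1000 : ℝ)] : Matrix (Fin 2) (Fin 2) ℝ) = !![(1000 : ℝ), 0; 0, 1000] := by
    ext i j; fin_cases i <;> fin_cases j <;> simp
  rw [h]
  exact PivotTwoFourWitness.posSemidef_two_of_entries _ _ _ (by norm_num) (by norm_num) (by norm_num)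

/-- The pivot letter is even negative DEFINITE: `−J = 1000 · 1 ≻ 0`. [folklore] -/
theorem neg_J_posDef : (-(!![(-1000 : ℝ), 0; 0, (-1000 : ℝ)] : Matrix (Fin 2) (Fin 2) ℝ)).PosDef := by
  have h : -(!![(-1000 : ℝ), 0; 0, (-1000 : ℝ)] : Matrix (Fin 2) (Fin 2) ℝ) = Matrix.diagonal ![(1000 : ℝ), 1000] := by
    ext i j; fin_cases i <;> fin_cases j <;> simp
  rw [h, Matrix.posDef_diagonal_iff]
  intro i; fin_cases i <;> norm_num

/-- The four letters are positive semidefinite (rank one: non-negative diagonal, vanishing determinant). [folklore] -/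
theorem P_posSemidef : ∀ k : Fin 4,
    ((![!![(140 : ℝ), 560; 560, 2240], !![(3000 : ℝ), 3000; 3000, 3000], !![(5400 : ℝ), 3600; 3600, 2400],
          !![(3 : ℝ), 24; 24, 192]] : Fin 4 → Matrix (Fin 2) (Fin 2) ℝ) k).PosSemidef := by
  intro k
  fin_cases k
  · exact PivotTwoFourWitness.posSemidef_two_of_entries _ _ _ (by norm_num) (by norm_num) (by norm_num)
  · exact PivotTwoFourWitness.posSemidef_two_of_entries _ _ _ (by norm_num) (by norm_num) (by norm_num)
  · exact PivotTwoFourWitness.posSemidef_two_of_entries _ _ _ (by norm_num) (by norm_num) (by norm_num)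
  · exact PivotTwoFourWitness.posSemidef_two_of_entries _ _ _ (by norm_num) (by norm_num) (by norm_num)

/-- **`Z₊ ≥ 6`** for the pencil: `det F` takes the signs `+ − + − + − +` at the seven increasing positive rationals
`1/100, 9/20, 4/5, 6/5, 7/4, 8, 100`. [folklore] -/
theorem six_le_pivotPosRoots :
    6 ≤ pivotPosRoots 6 (![7, 5, 0, 12] : Fin 4 → ℕ) (!![(-1000 : ℝ), 0; 0, (-1000 : ℝ)] : Matrix (Fin 2) (Fin 2) ℝ)
      (![!![(140 : ℝ), 560; 560, 2240], !![(3000 : ℝ), 3000; 3000, 3000], !![(5400 : ℝ), 3600; 3600, 2400],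
          !![(3 : ℝ), 24; 24, 192]] : Fin 4 → Matrix (Fin 2) (Fin 2) ℝ) :=
  le_pivotPosRoots_of_certificate (N := 6) eval_det
    ![1 / 100, 9 / 20, 4 / 5, 6 / 5, 7 / 4, 8, 100]
    (by
      refine Fin.strictMono_iff_lt_succ.2 fun j => ?_
      fin_cases j <;> simp only [Fin.castSucc_mk, Fin.succ_mk] <;> norm_num)
    (by intro j; fin_cases j <;> norm_num)
    (by intro j; fin_cases j <;> simp only [Fin.castSucc_mk, Fin.succ_mk] <;> norm_num)

/-- **THE NSD-PIVOT K-FREE LAW IS FALSE at `n = 2`**: it is NOT the case that every `2 × 2` pivot pencil with a negative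
semidefinite pivot letter and positive semidefinite letters has at most `2 · 2` distinct positive determinant zeros
(whatever the number of letters and the exponents). [folklore] -/
theorem not_nsdPivotLaw_two :
    ¬ (∀ (K e : ℕ) (d : Fin K → ℕ) (J : Matrix (Fin 2) (Fin 2) ℝ) (P : Fin K → Matrix (Fin 2) (Fin 2) ℝ),
        J.IsSymm → (-J).PosSemidef → (∀ k, (P k).PosSemidef) → pivotPosRoots e d J P ≤ 2 * 2) := by
  intro h
  exact absurd (le_trans six_le_pivotPosRoots (h 4 6 _ _ _ J_isSymm neg_J_posSemidef P_posSemidef)) (by norm_num)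

/-- The same with a negative DEFINITE pivot (the memo's Case B normal form `J = −c·1`): still no bound `2n`. [folklore] -/
theorem not_negDefPivotLaw_two :
    ¬ (∀ (K e : ℕ) (d : Fin K → ℕ) (J : Matrix (Fin 2) (Fin 2) ℝ) (P : Fin K → Matrix (Fin 2) (Fin 2) ℝ),
        J.IsSymm → (-J).PosDef → (∀ k, (P k).PosSemidef) → pivotPosRoots e d J P ≤ 2 * 2) := by
  intro h
  exact absurd (le_trans six_le_pivotPosRoots (h 4 6 _ _ _ J_isSymm neg_J_posDef P_posSemidef)) (by norm_num)

end Summit.ValiantsHypothesis.ValiantsHypothesis.Theorems.LacunarySymmetroidMatrixDescartes.Pivot.NsdPivotSix
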